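/-
Copyright (c) 2026. All rights reserved.
Released under Apache 2.0 license as described in the file LICENSE.
Authors: abc-iut cell — seat abc-iut-L6-t15 (gen 3): proof-only companion to `HolomorphicCores`
([AbsTopIII] Prop 2.5), no new definitions.
-/
import Literature.AnabelianGeometry.AbsoluteAnabelian.ParallelogramsPlanarChains

/-!
# Planar geometry behind [AbsTopIII] Prop 2.5, IV: the boundary of a parallelogram

Proof-only companion (no definitions) to `HolomorphicCores.lean`, continuing
`ParallelogramsPlanarChains`.  In the affine frame `A` of a non-degenerate parallelogram
`P = openParallelogram z v w` (so `P = A '' (0,1)²`, `P̄ = A '' [0,1]²`):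

* the four closed edges of `P` are the `A`-images of the four edges of the unit square, i.e. the segments
  `[z, z+v]`, `[z+w, z+w+v]`, `[z, z+w]`, `[z+v, z+v+w]`;
* `P̄ ∖ P = A '' ([0,1]² ∖ (0,1)²)`, and (Prop 2.5 (b), the key planar fact behind "sides") a closed segment
  contained in `P̄ ∖ P` lies in one of the four edges;
* for `Q ∈ 𝒬` (`𝒮(U) ⊆ 𝒬 ⊆ 𝒫(U)`) with `val '' Q = P`: the `∂𝒬`-parallelogram `∂Q = Q̄ ∖ Q` of Prop 2.5 (b)
  is the trace of `P̄ ∖ P`.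

Refereed classical mathematics (S. Mochizuki, *Topics in absolute anabelian geometry III*, §2; kurims
pages); nothing here bears on the disputed parts of IUT.
-/

namespace Literature.AnabelianGeometry.AbsoluteAnabelian

open _root_.Complex _root_.Set _root_.Topology _root_.Filter _root_.Metric

noncomputable section

/-! ### Edges of a parallelogram in its frame -/

/-- The frame maps the horizontal edge `[0,1] × {t₀}` onto the segment `[z + t₀ w, z + t₀ w + v]`.
(Auxiliary.) [cite: MochizukiAbsTopIII2015, Proposition 2.5 (proof) pp.55–57] -/
theorem image_frame_Icc_const {z v w : ℂ} {A : ℂ → ℂ}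
    (hA : ∀ p : ℂ, A p = z + (p.re : ℂ) * v + (p.im : ℂ) * w) (t₀ : ℝ) :
    A '' (Icc 0 1 ×ℂ {t₀}) = segment ℝ (z + (t₀ : ℂ) * w) (z + (t₀ : ℂ) * w + v) := by
  rw [segment_eq_image_lineMap]
  ext x
  simp only [mem_image, mem_reProdIm, mem_singleton_iff, mem_Icc]
  constructor
  · rintro ⟨p, ⟨hp, hp0⟩, rfl⟩
    refine ⟨p.re, hp, ?_⟩
    rw [lineMap_apply_complex, hA, hp0]; ring
  · rintro ⟨θ, hθ, rfl⟩
    refine ⟨⟨θ, t₀⟩, ⟨hθ, rfl⟩, ?_⟩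
    rw [lineMap_apply_complex, hA]; push_cast; ring

/-- The frame maps the vertical edge `{s₀} × [0,1]` onto the segment `[z + s₀ v, z + s₀ v + w]`.
(Auxiliary.) [cite: MochizukiAbsTopIII2015, Proposition 2.5 (proof) pp.55–57] -/
theorem image_frame_const_Icc {z v w : ℂ} {A : ℂ → ℂ}
    (hA : ∀ p : ℂ, A p = z + (p.re : ℂ) * v + (p.im : ℂ) * w) (s₀ : ℝ) :
    A '' ({s₀} ×ℂ Icc 0 1) = segment ℝ (z + (s₀ : ℂ) * v) (z + (s₀ : ℂ) * v + w) := by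
  rw [segment_eq_image_lineMap]
  ext x
  simp only [mem_image, mem_reProdIm, mem_singleton_iff, mem_Icc]
  constructor
  · rintro ⟨p, ⟨hp0, hp⟩, rfl⟩
    refine ⟨p.im, hp, ?_⟩
    rw [lineMap_apply_complex, hA, hp0]; ring
  · rintro ⟨θ, hθ, rfl⟩
    refine ⟨⟨s₀, θ⟩, ⟨rfl, hθ⟩, ?_⟩
    rw [lineMap_apply_complex, hA]; push_cast; ring

/-- `P̄ ∖ P` in the frame: the image of the boundary `[0,1]² ∖ (0,1)²` of the unit square.
(Auxiliary.) [cite: MochizukiAbsTopIII2015, Proposition 2.5 (b) p.56] -/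
theorem closure_diff_openParallelogram_eq_image {z v w : ℂ} (h : LinearIndependent ℝ ![v, w])
    {A : ℂ ≃ₜ ℂ} (hA : ∀ p : ℂ, A p = z + (p.re : ℂ) * v + (p.im : ℂ) * w) :
    closure (openParallelogram z v w) \ openParallelogram z v w =
      A '' (Icc 0 1 ×ℂ Icc 0 1 \ Ioo 0 1 ×ℂ Ioo 0 1) := by
  rw [closure_openParallelogram h hA, openParallelogram_eq_image z v w hA, image_sdiff A.injective]

/-- A point of the closed unit square outside the open unit square has a coordinate equal to `0` or `1`.
(Auxiliary.) [cite: MochizukiAbsTopIII2015, Proposition 2.5 (proof) pp.55–57] -/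
theorem re_im_eq_of_mem_sq_boundary {p : ℂ} (hp : p ∈ Icc (0 : ℝ) 1 ×ℂ Icc (0 : ℝ) 1 \ Ioo 0 1 ×ℂ Ioo 0 1) :
    p.re = 0 ∨ p.re = 1 ∨ p.im = 0 ∨ p.im = 1 := by
  obtain ⟨⟨⟨h1, h2⟩, h3, h4⟩, hn⟩ := hp
  simp only [mem_reProdIm, mem_Ioo, not_and_or, not_lt] at hn
  rcases hn with (h | h) | (h | h)
  · exact Or.inl (le_antisymm h h1)
  · exact Or.inr (Or.inl (le_antisymm h2 h))
  · exact Or.inr (Or.inr (Or.inl (le_antisymm h h3)))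
  · exact Or.inr (Or.inr (Or.inr (le_antisymm h4 h)))

/-- Coordinates along a segment: the real part of `lineMap a b θ`.
(Auxiliary.) [cite: MochizukiAbsTopIII2015, Proposition 2.5 (proof) pp.55–57] -/
theorem re_lineMap (a b : ℂ) (θ : ℝ) : (AffineMap.lineMap a b θ : ℂ).re = a.re + θ * (b.re - a.re) := by
  rw [lineMap_apply_complex]; simp

/-- Coordinates along a segment: the imaginary part of `lineMap a b θ`.
(Auxiliary.) [cite: MochizukiAbsTopIII2015, Proposition 2.5 (proof) pp.55–57] -/
theorem im_lineMap (a b : ℂ) (θ : ℝ) : (AffineMap.lineMap a b θ : ℂ).im = a.im + θ * (b.im - a.im) := by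
  rw [lineMap_apply_complex]; simp

/-- **Prop 2.5 (b)**, the planar fact behind "sides", in coordinates: a closed segment contained in the
boundary `[0,1]² ∖ (0,1)²` of the unit square lies in one of the four edges.
[cite: MochizukiAbsTopIII2015, Proposition 2.5 (b) p.56] -/
theorem segment_subset_edge_of_subset_sq_boundary {a b : ℂ}
    (hab : segment ℝ a b ⊆ Icc (0 : ℝ) 1 ×ℂ Icc (0 : ℝ) 1 \ Ioo 0 1 ×ℂ Ioo 0 1) :
    segment ℝ a b ⊆ Icc 0 1 ×ℂ {(0 : ℝ)} ∨ segment ℝ a b ⊆ Icc 0 1 ×ℂ {(1 : ℝ)} ∨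
      segment ℝ a b ⊆ {(0 : ℝ)} ×ℂ Icc 0 1 ∨ segment ℝ a b ⊆ {(1 : ℝ)} ×ℂ Icc 0 1 := by
  have ha := hab (left_mem_segment ℝ a b)
  have hb := hab (right_mem_segment ℝ a b)
  have hm : (AffineMap.lineMap a b (2⁻¹ : ℝ) : ℂ) ∈ segment ℝ a b := by
    rw [segment_eq_image_lineMap]; exact ⟨2⁻¹, by norm_num, rfl⟩
  have hre : ∀ x ∈ segment ℝ a b, ∃ θ : ℝ, x.re = a.re + θ * (b.re - a.re) ∧
      x.im = a.im + θ * (b.im - a.im) := by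
    intro x hx
    rw [segment_eq_image_lineMap] at hx
    obtain ⟨θ, -, rfl⟩ := hx
    exact ⟨θ, re_lineMap a b θ, im_lineMap a b θ⟩
  obtain ⟨⟨⟨ha1, ha2⟩, ha3, ha4⟩, -⟩ := ha
  obtain ⟨⟨⟨hb1, hb2⟩, hb3, hb4⟩, -⟩ := hb
  rcases re_im_eq_of_mem_sq_boundary (hab hm) with h | h | h | h
  · rw [re_lineMap] at h
    have h1 : a.re = 0 := by linarith
    have h2 : b.re = 0 := by linarith
    refine Or.inr (Or.inr (Or.inl fun x hx => ⟨?_, (hab hx).1.2⟩))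
    obtain ⟨θ, hθ, -⟩ := hre x hx
    rw [mem_preimage, mem_singleton_iff, hθ, h1, h2]; ring
  · rw [re_lineMap] at h
    have h1 : a.re = 1 := by linarith
    have h2 : b.re = 1 := by linarith
    refine Or.inr (Or.inr (Or.inr fun x hx => ⟨?_, (hab hx).1.2⟩))
    obtain ⟨θ, hθ, -⟩ := hre x hx
    rw [mem_preimage, mem_singleton_iff, hθ, h1, h2]; ring
  · rw [im_lineMap] at h
    have h1 : a.im = 0 := by linarith
    have h2 : b.im = 0 := by linarith
    refine Or.inl fun x hx => ⟨(hab hx).1.1, ?_⟩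
    obtain ⟨θ, -, hθ⟩ := hre x hx
    rw [mem_preimage, mem_singleton_iff, hθ, h1, h2]; ring
  · rw [im_lineMap] at h
    have h1 : a.im = 1 := by linarith
    have h2 : b.im = 1 := by linarith
    refine Or.inr (Or.inl fun x hx => ⟨(hab hx).1.1, ?_⟩)
    obtain ⟨θ, -, hθ⟩ := hre x hx
    rw [mem_preimage, mem_singleton_iff, hθ, h1, h2]; ring

/-- **Prop 2.5 (b)**, the planar fact behind "sides": a closed segment contained in `P̄ ∖ P` for a
non-degenerate parallelogram `P = openParallelogram z v w` lies in one of its four closed edges (described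
in the frame `A`). [cite: MochizukiAbsTopIII2015, Proposition 2.5 (b) p.56] -/
theorem segment_subset_edge_of_subset_boundary {z v w : ℂ} (h : LinearIndependent ℝ ![v, w])
    {A : ℂ ≃ₜ ℂ} (hA : ∀ p : ℂ, A p = z + (p.re : ℂ) * v + (p.im : ℂ) * w) {a b : ℂ}
    (hab : segment ℝ a b ⊆ closure (openParallelogram z v w) \ openParallelogram z v w) :
    segment ℝ a b ⊆ A '' (Icc 0 1 ×ℂ {(0 : ℝ)}) ∨ segment ℝ a b ⊆ A '' (Icc 0 1 ×ℂ {(1 : ℝ)}) ∨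
      segment ℝ a b ⊆ A '' ({(0 : ℝ)} ×ℂ Icc 0 1) ∨ segment ℝ a b ⊆ A '' ({(1 : ℝ)} ×ℂ Icc 0 1) := by
  obtain ⟨f, hf⟩ := exists_affineMap_frame z v w
  have hfA : ⇑f = ⇑A := funext fun p => by rw [hf, hA]
  set a' := A.symm a
  set b' := A.symm b
  have hseg : segment ℝ a b = A '' segment ℝ a' b' := by
    rw [← hfA, image_segment, hfA, A.apply_symm_apply, A.apply_symm_apply]
  rw [hseg, closure_diff_openParallelogram_eq_image h hA, image_subset_image_iff A.injective] at hab
  rw [hseg, image_subset_image_iff A.injective, image_subset_image_iff A.injective,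
    image_subset_image_iff A.injective, image_subset_image_iff A.injective]
  exact segment_subset_edge_of_subset_sq_boundary hab

/-! ### Prop 2.5 (b): the `∂𝒬`-parallelogram -/

/-- **Prop 2.5 (b)**: for `Q ∈ 𝒬` (`𝒮(U) ⊆ 𝒬 ⊆ 𝒫(U)`) with `val '' Q = P`, the `∂𝒬`-parallelogram
`∂Q := Q̄ ∖ Q` is the trace on `U` of `P̄ ∖ P`. [cite: MochizukiAbsTopIII2015, Proposition 2.5 (b) p.56] -/
theorem Parallelograms.boundaryOf_eq_of_subset {U : Set ℂ} (hU : IsOpen U) {𝒬 : Set (Set U)}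
    (h𝒬 : ∀ Q ∈ 𝒬, Subtype.val '' Q ∈ parallelogramsIn U)
    (h𝒮 : ∀ Q : Set U, Subtype.val '' Q ∈ squaresIn U → Q ∈ 𝒬) {Q : Set U} {P : Set ℂ}
    (hQP : Subtype.val '' Q = P) :
    Parallelograms.boundaryOf 𝒬 Q = Subtype.val ⁻¹' (closure P \ P) := by
  unfold Parallelograms.boundaryOf
  rw [Parallelograms.topology_eq_of_subset hU h𝒬 h𝒮,
    Topology.IsInducing.subtypeVal.closure_eq_preimage_closure_image, hQP, preimage_sdiff,
    ← hQP, preimage_image_eq Q Subtype.val_injective]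

/-- **Prop 2.5 (b)**, image form: `val '' ∂Q = P̄ ∖ P` when `P̄ ⊆ U`.
[cite: MochizukiAbsTopIII2015, Proposition 2.5 (b) p.56] -/
theorem Parallelograms.image_val_boundaryOf_eq_of_subset {U : Set ℂ} (hU : IsOpen U) {𝒬 : Set (Set U)}
    (h𝒬 : ∀ Q ∈ 𝒬, Subtype.val '' Q ∈ parallelogramsIn U)
    (h𝒮 : ∀ Q : Set U, Subtype.val '' Q ∈ squaresIn U → Q ∈ 𝒬) {Q : Set U} {P : Set ℂ}
    (hQP : Subtype.val '' Q = P) (hcl : closure P ⊆ U) :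
    Subtype.val '' Parallelograms.boundaryOf 𝒬 Q = closure P \ P := by
  rw [Parallelograms.boundaryOf_eq_of_subset hU h𝒬 h𝒮 hQP, image_preimage_eq_inter_range,
    Subtype.range_coe, inter_eq_left.2 (sdiff_subset.trans hcl)]

/-! ### Prop 2.5 (b): the sides of a parallelogram are its four edges -/

/-- The four edges of the unit square lie in its boundary `[0,1]² ∖ (0,1)²`.
(Auxiliary.) [cite: MochizukiAbsTopIII2015, Proposition 2.5 (proof) pp.55–57] -/
theorem sq_edge_subset_boundary {E : Set ℂ}
    (hE : E = Icc 0 1 ×ℂ {(0 : ℝ)} ∨ E = Icc 0 1 ×ℂ {(1 : ℝ)} ∨ E = {(0 : ℝ)} ×ℂ Icc 0 1 ∨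
      E = {(1 : ℝ)} ×ℂ Icc 0 1) :
    E ⊆ Icc (0 : ℝ) 1 ×ℂ Icc (0 : ℝ) 1 \ Ioo 0 1 ×ℂ Ioo 0 1 := by
  intro p hp
  simp only [Set.mem_sdiff, mem_reProdIm, mem_Icc, mem_Ioo, not_and_or, not_lt]
  rcases hE with rfl | rfl | rfl | rfl <;>
    simp only [mem_reProdIm, mem_Icc, mem_singleton_iff] at hp
  · exact ⟨⟨hp.1, by rw [hp.2]; norm_num⟩, Or.inr (Or.inl hp.2.le)⟩
  · exact ⟨⟨hp.1, by rw [hp.2]; norm_num⟩, Or.inr (Or.inr hp.2.ge)⟩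
  · exact ⟨⟨by rw [hp.1]; norm_num, hp.2⟩, Or.inl (Or.inl hp.1.le)⟩
  · exact ⟨⟨by rw [hp.1]; norm_num, hp.2⟩, Or.inl (Or.inr hp.1.ge)⟩

/-- The four edges of the unit square are pairwise non-nested.
(Auxiliary.) [cite: MochizukiAbsTopIII2015, Proposition 2.5 (proof) pp.55–57] -/
theorem sq_edge_eq_of_subset {E E' : Set ℂ}
    (hE : E = Icc 0 1 ×ℂ {(0 : ℝ)} ∨ E = Icc 0 1 ×ℂ {(1 : ℝ)} ∨ E = {(0 : ℝ)} ×ℂ Icc 0 1 ∨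
      E = {(1 : ℝ)} ×ℂ Icc 0 1)
    (hE' : E' = Icc 0 1 ×ℂ {(0 : ℝ)} ∨ E' = Icc 0 1 ×ℂ {(1 : ℝ)} ∨ E' = {(0 : ℝ)} ×ℂ Icc 0 1 ∨
      E' = {(1 : ℝ)} ×ℂ Icc 0 1) (h : E ⊆ E') : E = E' := by
  rcases hE with rfl | rfl | rfl | rfl <;> rcases hE' with rfl | rfl | rfl | rfl <;>
    first
    | rfl
    | (exfalso
       first
       | (have h1 := h (show (⟨2⁻¹, 0⟩ : ℂ) ∈ Icc (0 : ℝ) 1 ×ℂ {(0 : ℝ)} by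
            simp only [mem_reProdIm, mem_Icc, mem_singleton_iff]; norm_num)
          simp only [mem_reProdIm, mem_Icc, mem_singleton_iff] at h1; norm_num at h1)
       | (have h1 := h (show (⟨2⁻¹, 1⟩ : ℂ) ∈ Icc (0 : ℝ) 1 ×ℂ {(1 : ℝ)} by
            simp only [mem_reProdIm, mem_Icc, mem_singleton_iff]; norm_num)
          simp only [mem_reProdIm, mem_Icc, mem_singleton_iff] at h1; norm_num at h1)
       | (have h1 := h (show (⟨0, 2⁻¹⟩ : ℂ) ∈ {(0 : ℝ)} ×ℂ Icc (0 : ℝ) 1 by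
            simp only [mem_reProdIm, mem_Icc, mem_singleton_iff]; norm_num)
          simp only [mem_reProdIm, mem_Icc, mem_singleton_iff] at h1; norm_num at h1)
       | (have h1 := h (show (⟨1, 2⁻¹⟩ : ℂ) ∈ {(1 : ℝ)} ×ℂ Icc (0 : ℝ) 1 by
            simp only [mem_reProdIm, mem_Icc, mem_singleton_iff]; norm_num)
          simp only [mem_reProdIm, mem_Icc, mem_singleton_iff] at h1; norm_num at h1))

/-- The four edges of a non-degenerate parallelogram `P ⊆ U` (closure in `U`), as subsets of the subtype
`U`, are line segments of `(U, 𝒬)` for any `𝒮(U) ⊆ 𝒬 ⊆ 𝒫(U)`.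
(Auxiliary.) [cite: MochizukiAbsTopIII2015, Proposition 2.5 (b) p.56] -/
theorem Parallelograms.isLineSegment_edge {U : Set ℂ} (hU : IsOpen U) {𝒬 : Set (Set U)}
    (h𝒬 : ∀ Q ∈ 𝒬, Subtype.val '' Q ∈ parallelogramsIn U)
    (h𝒮 : ∀ Q : Set U, Subtype.val '' Q ∈ squaresIn U → Q ∈ 𝒬) {z v w : ℂ}
    (h : LinearIndependent ℝ ![v, w]) (hcl : closure (openParallelogram z v w) ⊆ U)
    {A : ℂ ≃ₜ ℂ} (hA : ∀ p : ℂ, A p = z + (p.re : ℂ) * v + (p.im : ℂ) * w) {E : Set ℂ}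
    (hE : E = Icc 0 1 ×ℂ {(0 : ℝ)} ∨ E = Icc 0 1 ×ℂ {(1 : ℝ)} ∨ E = {(0 : ℝ)} ×ℂ Icc 0 1 ∨
      E = {(1 : ℝ)} ×ℂ Icc 0 1) :
    Parallelograms.IsLineSegment 𝒬 (Subtype.val ⁻¹' (A '' E)) := by
  have hv : v ≠ 0 := by simpa using h.ne_zero 0
  have hw : w ≠ 0 := by simpa using h.ne_zero 1
  have hsub : A '' E ⊆ U :=
    (image_mono (sq_edge_subset_boundary hE)).trans
      ((closure_diff_openParallelogram_eq_image h hA).symm.le.trans (sdiff_subset.trans hcl))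
  rcases hE with rfl | rfl | rfl | rfl
  · rw [image_frame_Icc_const hA] at hsub ⊢
    exact Parallelograms.isLineSegment_of_segment_subset hU h𝒬 h𝒮 (by simpa using hv) hsub
  · rw [image_frame_Icc_const hA] at hsub ⊢
    exact Parallelograms.isLineSegment_of_segment_subset hU h𝒬 h𝒮 (by simpa using hv) hsub
  · rw [image_frame_const_Icc hA] at hsub ⊢
    exact Parallelograms.isLineSegment_of_segment_subset hU h𝒬 h𝒮 (by simpa using hw) hsub
  · rw [image_frame_const_Icc hA] at hsub ⊢
    exact Parallelograms.isLineSegment_of_segment_subset hU h𝒬 h𝒮 (by simpa using hw) hsub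

/-- **Prop 2.5 (b)**, sides: for `Q ∈ 𝒬` (`𝒮(U) ⊆ 𝒬 ⊆ 𝒫(U)`) with `val '' Q = openParallelogram z v w`
(non-degenerate, closure in `U`, frame `A`), the SIDES of `Q` — maximal line segments in `∂Q` — are exactly
the four closed edges of the parallelogram. [cite: MochizukiAbsTopIII2015, Proposition 2.5 (b) p.56] -/
theorem Parallelograms.isSide_iff_of_subset {U : Set ℂ} (hU : IsOpen U) {𝒬 : Set (Set U)}
    (h𝒬 : ∀ Q ∈ 𝒬, Subtype.val '' Q ∈ parallelogramsIn U)
    (h𝒮 : ∀ Q : Set U, Subtype.val '' Q ∈ squaresIn U → Q ∈ 𝒬) {Q : Set U} (hQ : Q ∈ 𝒬)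
    {z v w : ℂ} (hQe : Subtype.val '' Q = openParallelogram z v w) (h : LinearIndependent ℝ ![v, w])
    (hcl : closure (openParallelogram z v w) ⊆ U)
    {A : ℂ ≃ₜ ℂ} (hA : ∀ p : ℂ, A p = z + (p.re : ℂ) * v + (p.im : ℂ) * w) {S : Set U} :
    Parallelograms.IsSide 𝒬 Q S ↔
      ∃ E : Set ℂ, (E = Icc 0 1 ×ℂ {(0 : ℝ)} ∨ E = Icc 0 1 ×ℂ {(1 : ℝ)} ∨ E = {(0 : ℝ)} ×ℂ Icc 0 1 ∨
        E = {(1 : ℝ)} ×ℂ Icc 0 1) ∧ S = Subtype.val ⁻¹' (A '' E) := by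
  have hbd := Parallelograms.boundaryOf_eq_of_subset hU h𝒬 h𝒮 hQe
  have hbd' : Parallelograms.boundaryOf 𝒬 Q =
      Subtype.val ⁻¹' (A '' (Icc 0 1 ×ℂ Icc 0 1 \ Ioo 0 1 ×ℂ Ioo 0 1)) := by
    rw [hbd, closure_diff_openParallelogram_eq_image h hA]
  -- a line segment inside `∂Q` lies inside one edge
  have key : ∀ S' : Set U, Parallelograms.IsLineSegment 𝒬 S' → S' ⊆ Parallelograms.boundaryOf 𝒬 Q →
      ∃ E : Set ℂ, (E = Icc 0 1 ×ℂ {(0 : ℝ)} ∨ E = Icc 0 1 ×ℂ {(1 : ℝ)} ∨ E = {(0 : ℝ)} ×ℂ Icc 0 1 ∨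
        E = {(1 : ℝ)} ×ℂ Icc 0 1) ∧ Subtype.val '' S' ⊆ A '' E := by
    intro S' hS' hS'b
    obtain ⟨a, b, -, hab⟩ := hS'.exists_eq_segment_of_subset hU h𝒬 h𝒮
    have hseg : segment ℝ a b ⊆ closure (openParallelogram z v w) \ openParallelogram z v w := by
      rw [← hab, ← Parallelograms.image_val_boundaryOf_eq_of_subset hU h𝒬 h𝒮 hQe hcl]
      exact image_mono hS'b
    rcases segment_subset_edge_of_subset_boundary h hA hseg with h1 | h1 | h1 | h1
    · exact ⟨_, Or.inl rfl, hab ▸ h1⟩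
    · exact ⟨_, Or.inr (Or.inl rfl), hab ▸ h1⟩
    · exact ⟨_, Or.inr (Or.inr (Or.inl rfl)), hab ▸ h1⟩
    · exact ⟨_, Or.inr (Or.inr (Or.inr rfl)), hab ▸ h1⟩
  have hedge_sub : ∀ {E : Set ℂ}, (E = Icc 0 1 ×ℂ {(0 : ℝ)} ∨ E = Icc 0 1 ×ℂ {(1 : ℝ)} ∨
      E = {(0 : ℝ)} ×ℂ Icc 0 1 ∨ E = {(1 : ℝ)} ×ℂ Icc 0 1) →
      (Subtype.val ⁻¹' (A '' E) : Set U) ⊆ Parallelograms.boundaryOf 𝒬 Q := fun hE => by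
    rw [hbd']; exact preimage_mono (image_mono (sq_edge_subset_boundary hE))
  have hedgeU : ∀ {E : Set ℂ}, (E = Icc 0 1 ×ℂ {(0 : ℝ)} ∨ E = Icc 0 1 ×ℂ {(1 : ℝ)} ∨
      E = {(0 : ℝ)} ×ℂ Icc 0 1 ∨ E = {(1 : ℝ)} ×ℂ Icc 0 1) → A '' E ⊆ U := fun hE =>
    (image_mono (sq_edge_subset_boundary hE)).trans
      ((closure_diff_openParallelogram_eq_image h hA).symm.le.trans (sdiff_subset.trans hcl))
  have himE : ∀ {E : Set ℂ}, A '' E ⊆ U → Subtype.val '' (Subtype.val ⁻¹' (A '' E) : Set U) = A '' E :=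
    fun hE => by rw [image_preimage_eq_inter_range, Subtype.range_coe, inter_eq_left.2 hE]
  constructor
  · rintro ⟨-, hls, hsub, hmax⟩
    obtain ⟨E, hE, hSE⟩ := key S hls hsub
    refine ⟨E, hE, (hmax _ (Parallelograms.isLineSegment_edge hU h𝒬 h𝒮 h hcl hA hE) (hedge_sub hE)
      ?_).symm⟩
    intro x hx
    exact hSE (mem_image_of_mem _ hx)
  · rintro ⟨E, hE, rfl⟩
    refine ⟨hQ, Parallelograms.isLineSegment_edge hU h𝒬 h𝒮 h hcl hA hE, hedge_sub hE, ?_⟩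
    intro S' hS' hS'b hSS'
    obtain ⟨E', hE', hS'E'⟩ := key S' hS' hS'b
    have hEE' : A '' E ⊆ A '' E' := by
      rw [← himE (hedgeU hE)]
      exact (image_mono hSS').trans hS'E'
    rw [image_subset_image_iff A.injective] at hEE'
    obtain rfl := sq_edge_eq_of_subset hE hE' hEE'
    refine Subset.antisymm ?_ hSS'
    intro x hx
    exact hS'E' (mem_image_of_mem _ hx)

end

end Literature.AnabelianGeometry.AbsoluteAnabelian
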